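import Summits.BirchSwinnertonDyer.BirchSwinnertonDyer.Theorems.ResidualThetaTransportAtTwoThetaLayerLambdaCongruenceAtTwoCuspSpanGenerationB1
import HarnessLib

/-!
# Route `ResidualThetaTransportAtTwo`, cruxes Kan⁺ (stmt-BirchSwinnertonDyer-20688) / Kμ⁺ / 21437: the CONJUGATION CRITERION —
# at EVERY level `N`, a character killing the `4^k`-classes kills every `γ` one of whose `T`-conjugates of an `L_t`-translate
# has lower-right entry `±4^k`; in particular every `γ` with `d(γ) ≡ ±4^k (mod N)` and `a(γ) ∣ c(γ)/N ∓ 1`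

Cell `bsd-wall`, lead prover `bsd-wall-rtt-p3` g9 (2026-08-28). THEOREMS ONLY; `--supports stmt-BirchSwinnertonDyer-20688`; BSD is not
proved by this. The point (missed by the generation statement (T_N)): `χ` is a homomorphism to an abelian group, so it kills every
CONJUGATE `g s g⁻¹` of a `4^k`-class element `s`, not only `s`. With `L_t = (1 0; Nt 1)` and `T_m = (1 m; 0 1)`:
`T_m⁻¹ (L_t γ) T_m` has lower-right entry `d + tNb + m(c + tNa)` (`γ = (a b; c d)`), so

* `chi_eq_zero_of_conj_witness` — if `d + tNb + m(c + tNa) = ε4^k` for some integers `t, m`, `k ≥ 1`, `ε = ±1`, then `χ γ = 0`;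
* `chi_eq_zero_of_apply_zero_zero_dvd` — if `d ≡ ε4^k (mod N)` (i.e. `d̄ ∈ ±⟨4⟩`, automatic for the classes that matter) and
  `a ∣ c/N − 1` or `a ∣ c/N + 1` (take `t` with `c/N + ta = ±1`, then `m` is forced), then `χ γ = 0`. E.g. every such `γ` with
  `|a| ∈ {1, 2, 3, 4, 6}`. (By `γ ↦ γ⁻¹` the same holds with `d ∣ c/N ± 1`; by `L`-conjugation with `a ∣ b ± 1`, `d ∣ b ± 1` — not spelled out.)

The general form («some divisor of `(εa4^k − 1)/N` is `≡ c/N (mod a)`») and its consequence «(G′)_N for all odd `N` under GRH via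
Artin primes in progressions (Lenstra 1977)» are recorded in `Cruxes/ThetaLayerLambdaCongruenceAtTwo/Lines/birth-generation.md` §4,
not here. References: [Rademacher1929]; [Knapp1993] Prop. 11.1; [Pollack2003] Conj. 6.3.
-/

set_option autoImplicit false
set_option linter.dupNamespace false

noncomputable section

open scoped MatrixGroups

open CongruenceSubgroup

namespace Summit.BirchSwinnertonDyer.BirchSwinnertonDyer.Theorems.SignedMuAtTwo

variable {N : ℕ} {χ : Gamma0 N → ZMod 2}

/-- **Conjugation criterion (explicit witnesses).** For additive `χ` killing the small-trace elements and the `4^k`-classes, and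
`γ = (a b; c d) ∈ Γ₀(N)`: if `d + tNb + m(c + tNa) = ε4^k` (`k ≥ 1`, `|ε| = 1`) for some integers `t, m`, then `χ γ = 0` — the element
`T_m⁻¹ L_t γ T_m` is a `4^k`-class and `χ(T_m⁻¹ x T_m) = χ x`, `χ(L_t) = 0`. [cite: Rademacher1929, §1] -/
theorem chi_eq_zero_of_conj_witness
    (hadd : ∀ γ δ : Gamma0 N, χ (γ * δ) = χ γ + χ δ)
    (hsmall : ∀ γ : Gamma0 N, ((γ : SL(2, ℤ)) 0 0 + (γ : SL(2, ℤ)) 1 1).natAbs ≤ 2 → χ γ = 0)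
    (hkill : ∀ γ : Gamma0 N, (∃ k : ℕ, 1 ≤ k ∧ ((γ : SL(2, ℤ)) 1 1).natAbs = 4 ^ k) → χ γ = 0)
    (γ : Gamma0 N) (t m : ℤ) (k : ℕ) (hk : 1 ≤ k) (ε : ℤ) (hε : ε.natAbs = 1)
    (h : (γ : SL(2, ℤ)) 1 1 + t * N * (γ : SL(2, ℤ)) 0 1 + m * ((γ : SL(2, ℤ)) 1 0 + t * N * (γ : SL(2, ℤ)) 0 0) = ε * 4 ^ k) :
    χ γ = 0 := by
  obtain ⟨L, hL00, hL01, hL10, hL11⟩ :=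
    ThetaLayerLambdaCongruenceAtTwo.exists_gamma0_entries (N := N) 1 0 ((N : ℤ) * t) 1 (by ring) (dvd_mul_right _ _)
  obtain ⟨Tm, hT00, hT01, hT10, hT11⟩ :=
    ThetaLayerLambdaCongruenceAtTwo.exists_gamma0_entries (N := N) 1 m 0 1 (by ring) (dvd_zero _)
  have hL : χ L = 0 := hsmall L (by rw [hL00, hL11]; rfl)
  have hT : χ Tm = 0 := hsmall Tm (by rw [hT00, hT11]; rfl)
  have h1 : χ 1 = 0 := by have := hadd 1 1; rw [mul_one] at this; linear_combination (-1 : ZMod 2) * this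
  have hTinv : χ Tm⁻¹ = 0 := by
    have := hadd Tm Tm⁻¹; rw [mul_inv_cancel, h1, hT, zero_add] at this; exact this.symm
  -- entries of `X = L γ`
  have hX10 : ((L * γ : Gamma0 N) : SL(2, ℤ)) 1 0 = (γ : SL(2, ℤ)) 1 0 + t * N * (γ : SL(2, ℤ)) 0 0 := by
    rw [ThetaLayerLambdaCongruenceAtTwo.gamma0_mul_apply_one_zero, hL10, hL11]; ring
  have hX11 : ((L * γ : Gamma0 N) : SL(2, ℤ)) 1 1 = (γ : SL(2, ℤ)) 1 1 + t * N * (γ : SL(2, ℤ)) 0 1 := by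
    rw [gamma0_mul_apply_one_one', hL10, hL11]; ring
  -- lower row of `X Tm`, then of `Tm⁻¹ (X Tm)`
  have hY10 : ((L * γ * Tm : Gamma0 N) : SL(2, ℤ)) 1 0 = (γ : SL(2, ℤ)) 1 0 + t * N * (γ : SL(2, ℤ)) 0 0 := by
    rw [ThetaLayerLambdaCongruenceAtTwo.gamma0_mul_apply_one_zero, hX10, hX11, hT00, hT10]; ring
  have hY11 : ((L * γ * Tm : Gamma0 N) : SL(2, ℤ)) 1 1 = ε * 4 ^ k := by
    rw [gamma0_mul_apply_one_one', hX10, hX11, hT01, hT11]; linear_combination h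
  have hI10 : ((Tm⁻¹ : Gamma0 N) : SL(2, ℤ)) 1 0 = 0 := by
    have e : ((Tm⁻¹ : Gamma0 N) : SL(2, ℤ)) 1 0 = -((Tm : Gamma0 N) : SL(2, ℤ)) 1 0 := by
      rw [InvMemClass.coe_inv, Matrix.SpecialLinearGroup.SL2_inv_expl]; rfl
    rw [e, hT10, neg_zero]
  have hZ11 : ((Tm⁻¹ * (L * γ * Tm) : Gamma0 N) : SL(2, ℤ)) 1 1 = ε * 4 ^ k := by
    rw [gamma0_mul_apply_one_one', hI10, zero_mul, zero_add, coe_inv_apply_one_one, hT00, one_mul, hY11]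
  have hZ : χ (Tm⁻¹ * (L * γ * Tm)) = 0 :=
    hkill _ ⟨k, hk, by rw [hZ11, Int.natAbs_mul, hε, one_mul, Int.natAbs_pow]; rfl⟩
  rw [hadd, hadd, hadd, hTinv, hL, hT, zero_add, zero_add, add_zero] at hZ
  exact hZ

/-- **Divisibility form.** If `d(γ) ≡ ε4^k (mod N)` (`k ≥ 1`, `|ε| = 1`) and `a(γ) ∣ c(γ)/N ∓ 1` (precisely: `c(γ) = N c'` and
`c' + t a = g` with `g = ±1` for some integer `t`), then `χ γ = 0`: with this `t`, `c + tNa = Ng = ±N` divides `ε4^k − d − tNb`.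
Every `γ` with `d̄ ∈ ±⟨4⟩` and `|a| ∈ {1, 2, 3, 4, 6}` qualifies (`c'` is prime to `a`). [cite: Rademacher1929, §1] -/
theorem chi_eq_zero_of_apply_zero_zero_dvd
    (hadd : ∀ γ δ : Gamma0 N, χ (γ * δ) = χ γ + χ δ)
    (hsmall : ∀ γ : Gamma0 N, ((γ : SL(2, ℤ)) 0 0 + (γ : SL(2, ℤ)) 1 1).natAbs ≤ 2 → χ γ = 0)
    (hkill : ∀ γ : Gamma0 N, (∃ k : ℕ, 1 ≤ k ∧ ((γ : SL(2, ℤ)) 1 1).natAbs = 4 ^ k) → χ γ = 0)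
    (γ : Gamma0 N) (k : ℕ) (hk : 1 ≤ k) (ε : ℤ) (hε : ε.natAbs = 1)
    (hd : (N : ℤ) ∣ (γ : SL(2, ℤ)) 1 1 - ε * 4 ^ k)
    (c' t g : ℤ) (hc : (γ : SL(2, ℤ)) 1 0 = N * c') (hg : c' + t * (γ : SL(2, ℤ)) 0 0 = g) (hg1 : g.natAbs = 1) :
    χ γ = 0 := by
  obtain ⟨n, hn⟩ := hd
  -- `m := -g * (n + t b)` works since `g * g = 1`
  have hgg : g * g = 1 := by
    rcases Int.natAbs_eq g with h | h <;> rw [hg1] at h <;> rw [h] <;> norm_num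
  refine chi_eq_zero_of_conj_witness hadd hsmall hkill γ t (-g * (n + t * (γ : SL(2, ℤ)) 0 1)) k hk ε hε ?_
  rw [hc]
  have : (N : ℤ) * c' + t * N * (γ : SL(2, ℤ)) 0 0 = N * g := by rw [← hg]; ring
  rw [this]
  linear_combination hn - ((N : ℤ) * (n + t * (γ : SL(2, ℤ)) 0 1)) * hgg

/-- **The arithmetic residue (W_N) ⟹ (G″)_N.** If every `γ = (a b; c d) ∈ Γ₀(N)` with `d ≡ 1 (mod N)` (`Gamma1' N`) admits integers
`t, m` and `k ≥ 1`, `|ε| = 1` with `d + tNb + m(c + tNa) = ε4^k` (a `T`-conjugate of an `L_t`-translate of `γ` is a `4^k`-class),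
then every additive `χ` killing the small-trace elements and the `4^k`-classes is `ψ ∘ d` with `ψ` multiplicative on units —
i.e. (G″)_N, hence the node `CuspSpanEvenAtTwo N`. (W_N) is a statement about `2 × 2` integer matrices only; it holds at every odd
`N ≤ 401` by the (T_N) certificates and is implied by GRH (memo §4.2, sketch). [cite: Rademacher1929, §1] [cite: Pollack2003, Conj. 6.3] -/
theorem cuspSpanTrace_of_gamma1_conj_witness [NeZero N]
    (hW : ∀ γ : Gamma0 N, γ ∈ Gamma1' N → ∃ (t m : ℤ) (k : ℕ) (ε : ℤ), 1 ≤ k ∧ ε.natAbs = 1 ∧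
      (γ : SL(2, ℤ)) 1 1 + t * N * (γ : SL(2, ℤ)) 0 1 + m * ((γ : SL(2, ℤ)) 1 0 + t * N * (γ : SL(2, ℤ)) 0 0) = ε * 4 ^ k) :
    ∀ χ : Gamma0 N → ZMod 2,
      (∀ γ δ : Gamma0 N, χ (γ * δ) = χ γ + χ δ) →
      (∀ γ : Gamma0 N, ((γ : SL(2, ℤ)) 0 0 + (γ : SL(2, ℤ)) 1 1).natAbs ≤ 2 → χ γ = 0) →
      (∀ γ : Gamma0 N, (∃ k : ℕ, 1 ≤ k ∧ ((γ : SL(2, ℤ)) 1 1).natAbs = 4 ^ k) → χ γ = 0) →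
      ∃ ψ : ZMod N → ZMod 2, (∀ x y : ZMod N, IsUnit x → IsUnit y → ψ (x * y) = ψ x + ψ y) ∧
        ∀ γ : Gamma0 N, χ γ = ψ ((((γ : SL(2, ℤ)) 1 1 : ℤ) : ZMod N)) := by
  classical
  intro χ hadd hsmall hkill
  have hK : ∀ γ : Gamma0 N, γ ∈ Gamma1' N → χ γ = 0 := by
    intro γ hγ
    obtain ⟨t, m, k, ε, hk, hε, h⟩ := hW γ hγ
    exact chi_eq_zero_of_conj_witness hadd hsmall hkill γ t m k hk ε hε h
  -- `χ` is constant on the fibres of `d mod N`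
  have hdep : ∀ γ δ : Gamma0 N,
      ((((γ : SL(2, ℤ)) 1 1 : ℤ) : ZMod N)) = ((((δ : SL(2, ℤ)) 1 1 : ℤ) : ZMod N)) → χ γ = χ δ := by
    intro γ δ h
    have hmem : δ⁻¹ * γ ∈ Gamma1' N := by
      rw [Gamma1_mem']
      change ((((δ⁻¹ * γ : Gamma0 N) : SL(2, ℤ)) 1 1 : ℤ) : ZMod N) = 1
      rw [cast_mul_apply_one_one, coe_inv_apply_one_one, h, mul_comm]
      exact gamma0_apply_one_one_mul_apply_zero_zero δ
    have h0 := hK _ hmem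
    rw [hadd, map_inv_eq_of_additive hadd] at h0
    have : χ γ = -χ δ := by linear_combination h0
    rw [this, ZMod.neg_eq_self_mod_two]
  refine ⟨fun x ↦ if h : ∃ γ : Gamma0 N, ((((γ : SL(2, ℤ)) 1 1 : ℤ) : ZMod N)) = x then χ h.choose else 0, ?_, ?_⟩
  · have hval : ∀ γ : Gamma0 N,
        (fun x : ZMod N ↦ if h : ∃ γ : Gamma0 N, ((((γ : SL(2, ℤ)) 1 1 : ℤ) : ZMod N)) = x then χ h.choose
          else 0) ((((γ : SL(2, ℤ)) 1 1 : ℤ) : ZMod N)) = χ γ := by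
      intro γ
      have hex : ∃ γ' : Gamma0 N, ((((γ' : SL(2, ℤ)) 1 1 : ℤ) : ZMod N)) = ((((γ : SL(2, ℤ)) 1 1 : ℤ) : ZMod N)) :=
        ⟨γ, rfl⟩
      simp only [dif_pos hex]
      exact hdep _ _ hex.choose_spec
    intro x y hx hy
    obtain ⟨γx, hγx⟩ := exists_gamma0_cast_apply_one_one_eq hx
    obtain ⟨γy, hγy⟩ := exists_gamma0_cast_apply_one_one_eq hy
    rw [← hγx, ← hγy, ← cast_mul_apply_one_one, hval, hval, hval, hadd]
  · intro γ
    have hex : ∃ γ' : Gamma0 N, ((((γ' : SL(2, ℤ)) 1 1 : ℤ) : ZMod N)) = ((((γ : SL(2, ℤ)) 1 1 : ℤ) : ZMod N)) :=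
      ⟨γ, rfl⟩
    simp only [dif_pos hex]
    exact (hdep _ _ hex.choose_spec).symm

/-- **(W_N) ⟹ the named node `CuspSpanEvenAtTwo N`.** [cite: Pollack2003, Conj. 6.3] -/
theorem cuspSpanEvenAtTwo_of_gamma1_conj_witness [NeZero N]
    (hW : ∀ γ : Gamma0 N, γ ∈ Gamma1' N → ∃ (t m : ℤ) (k : ℕ) (ε : ℤ), 1 ≤ k ∧ ε.natAbs = 1 ∧
      (γ : SL(2, ℤ)) 1 1 + t * N * (γ : SL(2, ℤ)) 0 1 + m * ((γ : SL(2, ℤ)) 1 0 + t * N * (γ : SL(2, ℤ)) 0 0) = ε * 4 ^ k) :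
    CuspSpanEvenAtTwo N :=
  cuspSpanEvenAtTwo_of_cuspSpanTrace (cuspSpanTrace_of_gamma1_conj_witness hW)

/-- **(W_N) for all odd N ⟹ the class-wide node** (the hypothesis of `flatMuZeroAtTwo_of_forall_cuspSpanEvenAtTwo` /
`signedMuAnalyticAtTwoPlus_of_abbesUllmo_of_forall_cuspSpanEvenAtTwo`). [cite: Pollack2003, Conj. 6.3] -/
theorem forall_cuspSpanEvenAtTwo_of_forall_gamma1_conj_witness
    (hW : ∀ (N : ℕ) [NeZero N], ¬ 2 ∣ N → ∀ γ : Gamma0 N, γ ∈ Gamma1' N → ∃ (t m : ℤ) (k : ℕ) (ε : ℤ),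
      1 ≤ k ∧ ε.natAbs = 1 ∧
      (γ : SL(2, ℤ)) 1 1 + t * N * (γ : SL(2, ℤ)) 0 1 + m * ((γ : SL(2, ℤ)) 1 0 + t * N * (γ : SL(2, ℤ)) 0 0) = ε * 4 ^ k) :
    ∀ (N : ℕ) [NeZero N], ¬ 2 ∣ N → CuspSpanEvenAtTwo N :=
  fun N _ hN ↦ cuspSpanEvenAtTwo_of_gamma1_conj_witness (hW N hN)

end Summit.BirchSwinnertonDyer.BirchSwinnertonDyer.Theorems.SignedMuAtTwo

end
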